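import Mathlib.Data.Nat.Factorization.Induction
import Summits.KontsevichZagierPeriods.KontsevichZagierPeriods.Theorems.HurwitzMicroSectorsNormalFormPrincipleDlogMoves
import Summits.KontsevichZagierPeriods.KontsevichZagierPeriods.Theorems.HurwitzMicroSectorsNormalFormPrincipleSplitMoves

/-!
# `NormalFormPrinciple` (stmt-KontsevichZagierPeriods-3869), line `SketchIdeator1` — leaf
# `stub_boxRigidity`, split-denominator layer: the normal form of a simple rational pole

Pure proof file (`--supports` the crux; siege attempt k11 on the registered sub-goal `nf_pole_one`).
It proves, from the LANDED move lemmas of this crux only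
(`…NormalFormPrincipleDlogMoves.lean`: merging, splitting, scaling of the dlog representations
`[(a,b), c/y]`; `…NormalFormPrincipleSplitMoves.lean`: affine moves of either orientation, point
representations), that a simple rational pole off the unit interval,
`T = [(0,1), c/(x − ρ)]` (`c, ρ ∈ ℚ`, `ρ ∉ [0,1]`), is congruent modulo `KZ.relations` to the
normal form "rational point + prime carriers":

`[T] = [pt, r] + Σ_{p ∈ S} [(1,p), C_p / y]`, `S` a finite set of primes, `r, C_p ∈ ℚ`
(here `r = 0`).

The chain of moves: one affine move (`y = x − ρ` if `ρ < 0`, `y = ρ − x` if `ρ > 1`) to a dlog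
representation `[(a, a+1), ±c/y]` with `0 < a ∈ ℚ`; one dilation by the denominator `D` of
`a = A/D` to `[(A, A+D), ±c/y]`; one splitting `[(1, A+D)] = [(1, A)] + [(A, A+D)]`; and the
logarithm law of the carriers `Λ(N, c) := [(1,N), c/y]` — `Λ(Mp, c) ≡ Λ(M, c) + Λ(p, c)` (split at
`M`, rescale `(M, Mp)` to `(1, p)`), `Λ(N, c + c') ≡ Λ(N, c) + Λ(N, c')` (merge) — whence
`Λ(N, c) ≡ Σ_p v_p(N) • Λ(p, c) ≡ Σ_p Λ(p, v_p(N) c)` by induction over the prime factorisation.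

Sources: M. Kontsevich, D. Zagier, *Periods* (2001), §1.1 (`log 2 = ∫₁² dx/x`), §1.2 rules (1), (2).
No definitions are introduced.
-/

noncomputable section

open MeasureTheory Set
open Literature.NumberTheory.Transcendental Literature.NumberTheory.Transcendental.KZ

namespace Summit.KontsevichZagierPeriods.HurwitzMicroSectors.NormalFormPrinciple.PiBox.Dlog

namespace PoleOneK11

/-! ## Bookkeeping in `FormalRep ⧸ relations` -/

/-- `x − y ∈ relations` gives equal classes in `FormalRep ⧸ relations`. [folklore] -/
theorem mk'_eq_of_sub_mem {x y : FormalRep} (h : x - y ∈ relations) :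
    QuotientAddGroup.mk' relations x = QuotientAddGroup.mk' relations y := by
  rw [QuotientAddGroup.mk'_apply, QuotientAddGroup.mk'_apply, QuotientAddGroup.eq_iff_sub_mem]
  exact h

/-- A relation has class `0` in `FormalRep ⧸ relations`. [folklore] -/
theorem mk'_eq_zero_of_mem {x : FormalRep} (h : x ∈ relations) :
    QuotientAddGroup.mk' relations x = 0 := by
  rwa [QuotientAddGroup.mk'_apply, QuotientAddGroup.eq_zero_iff]

/-- `x − y − z ∈ relations` gives `[x] = [y] + [z]` in `FormalRep ⧸ relations`. [folklore] -/
theorem mk'_eq_add_of_sub_sub_mem {x y z : FormalRep} (h : x - y - z ∈ relations) :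
    QuotientAddGroup.mk' relations x =
      QuotientAddGroup.mk' relations y + QuotientAddGroup.mk' relations z := by
  have h' := mk'_eq_zero_of_mem h
  rwa [map_sub, map_sub, sub_sub, sub_eq_zero] at h'

/-! ## The carriers `Λ(N, c) = [(1,N), c/y]` -/

section Carrier

variable {R : ℚ → ℚ → ℚ → IntegralRep 1}
  (hR : ∀ a b c, 0 < a → (R a b c).domain = {x | x 0 ∈ Set.Ioo (a:ℝ) b} ∧
    (R a b c).integrand = fun x => (c:ℝ) / x 0)
include hR

/-- **Additivity of the carriers in the numerator** (merging, rule 1b):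
`Λ(N, c + c') = Λ(N, c) + Λ(N, c')` modulo relations. [cite: KontsevichZagier2001, §1.2 rule (1)] -/
theorem carrier_add (N : ℕ) (c c' : ℚ) :
    QuotientAddGroup.mk' relations (of (R 1 N (c + c'))) =
      QuotientAddGroup.mk' relations (of (R 1 N c)) +
        QuotientAddGroup.mk' relations (of (R 1 N c')) :=
  mk'_eq_add_of_sub_sub_mem (dlog_merge_mem_relations (c := c) (c' := c')
    (R 1 N (c + c')) (R 1 N c) (R 1 N c')
    (hR 1 N (c + c') one_pos).1 (hR 1 N c one_pos).1 (hR 1 N c' one_pos).1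
    (by rw [(hR 1 N (c + c') one_pos).2]; exact fun _ _ => rfl)
    (by rw [(hR 1 N c one_pos).2]; exact fun _ _ => rfl)
    (by rw [(hR 1 N c' one_pos).2]; exact fun _ _ => rfl))

/-- **Integer multiples of a carrier**: `Λ(N, z c) = z • Λ(N, c)` modulo relations (`z ∈ ℤ`).
[cite: KontsevichZagier2001, §1.2 rule (1)] -/
theorem carrier_intCast_mul (N : ℕ) (z : ℤ) (c : ℚ) :
    QuotientAddGroup.mk' relations (of (R 1 N ((z : ℚ) * c))) =
      z • QuotientAddGroup.mk' relations (of (R 1 N c)) := by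
  let φ : ℚ →+ FormalRep ⧸ relations :=
    AddMonoidHom.mk' (fun c => QuotientAddGroup.mk' relations (of (R 1 N c))) (carrier_add hR N)
  have h := map_zsmul φ z c
  rw [zsmul_eq_mul] at h
  exact h

/-- **The empty carrier** `Λ(1, c) = [(1,1), c/y]` is a relation (null domain).
[cite: KontsevichZagier2001, §1.2 rule (1)] -/
theorem carrier_one (c : ℚ) : QuotientAddGroup.mk' relations (of (R 1 (1 : ℕ) c)) = 0 :=
  mk'_eq_zero_of_mem (slab_empty_mem_relations (R 1 (1 : ℕ) c) (hR 1 (1 : ℕ) c one_pos).1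
    (by norm_num))

/-- **Logarithm law of the carriers**: for `M, p ≥ 1`, `Λ(Mp, c) = Λ(M, c) + Λ(p, c)` modulo
relations — split `[(1, Mp)]` at `M` (rule 1a) and rescale `[(M, Mp), c/y]` to `[(1, p), c/y]` by
the dilation `y ↦ M y` (rule 2). [cite: KontsevichZagier2001, §1.2 rules (1), (2)] -/
theorem carrier_mul {M p : ℕ} (hM : 1 ≤ M) (hp : 1 ≤ p) (c : ℚ) :
    QuotientAddGroup.mk' relations (of (R 1 ((M * p : ℕ) : ℚ) c)) =
      QuotientAddGroup.mk' relations (of (R 1 M c)) +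
        QuotientAddGroup.mk' relations (of (R 1 p c)) := by
  have hM0 : (0:ℚ) < M := by exact_mod_cast hM
  -- split at `M`
  have h1 : of (R 1 ((M * p : ℕ) : ℚ) c) - of (R 1 M c) - of (R M ((M * p : ℕ) : ℚ) c) ∈
      relations := by
    refine split_mem_relations _ _ _ (hR 1 ((M * p : ℕ) : ℚ) c one_pos).1 (hR 1 M c one_pos).1
      (hR M ((M * p : ℕ) : ℚ) c hM0).1 ?_ ?_ ?_ ?_
    · exact_mod_cast hM
    · exact_mod_cast Nat.le_mul_of_pos_right M hp
    · rw [(hR 1 M c one_pos).2, (hR 1 ((M * p : ℕ) : ℚ) c one_pos).2]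
      exact fun _ _ => rfl
    · rw [(hR M ((M * p : ℕ) : ℚ) c hM0).2, (hR 1 ((M * p : ℕ) : ℚ) c one_pos).2]
      exact fun _ _ => rfl
  -- rescale `(1, p)` by `M`
  have h2 : of (R 1 p c) - of (R M ((M * p : ℕ) : ℚ) c) ∈ relations := by
    refine dlog_scale_mem_relations (s := (M:ℚ)) (c := c) (R 1 p c) (R M ((M * p : ℕ) : ℚ) c)
      (hR 1 p c one_pos).1 ?_ ?_ ?_ one_pos hM0
    · rw [(hR M ((M * p : ℕ) : ℚ) c hM0).1, mul_one, Nat.cast_mul]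
    · rw [(hR 1 p c one_pos).2]
      exact fun _ _ => rfl
    · rw [(hR M ((M * p : ℕ) : ℚ) c hM0).2]
      exact fun _ _ => rfl
  rw [mk'_eq_add_of_sub_sub_mem h1, mk'_eq_of_sub_mem h2]

/-- **Prime-carrier expansion**: for `N ≠ 0` with prime factors inside `S`,
`Λ(N, c) = Σ_{p ∈ S} v_p(N) • Λ(p, c)` modulo relations (induction over the prime factorisation,
unique factorisation being the only arithmetic input). [cite: KontsevichZagier2001, §1.2] -/
theorem carrier_eq_sum (c : ℚ) (S : Finset ℕ) :
    ∀ N : ℕ, N ≠ 0 → N.primeFactors ⊆ S →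
      QuotientAddGroup.mk' relations (of (R 1 N c)) =
        ∑ p ∈ S, (N.factorization p : ℤ) • QuotientAddGroup.mk' relations (of (R 1 p c)) := by
  intro N
  induction N using induction_on_primes with
  | zero => intro h; exact absurd rfl h
  | one =>
    intro _ _
    rw [carrier_one hR c, Nat.factorization_one]
    simp only [Finsupp.coe_zero, Pi.zero_apply, Nat.cast_zero, zero_zsmul, Finset.sum_const_zero]
  | prime_mul p a hp ih =>
    intro hpa hS
    have ha : a ≠ 0 := fun h => hpa (by rw [h, mul_zero])
    have hpS : p ∈ S := hS (Nat.mem_primeFactors.mpr ⟨hp, dvd_mul_right p a, hpa⟩)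
    have haS : a.primeFactors ⊆ S := (Nat.primeFactors_mono (dvd_mul_left a p) hpa).trans hS
    have hsingle : ∑ q ∈ S, (((Finsupp.single p 1 : ℕ →₀ ℕ) q : ℕ) : ℤ) •
        QuotientAddGroup.mk' relations (of (R 1 q c)) =
          QuotientAddGroup.mk' relations (of (R 1 p c)) := by
      rw [Finset.sum_eq_single p, Finsupp.single_eq_same, Nat.cast_one, one_zsmul]
      · intro q _ hqp
        rw [Finsupp.single_eq_of_ne hqp, Nat.cast_zero, zero_zsmul]
      · intro h
        exact absurd hpS h
    rw [carrier_mul hR hp.one_lt.le (Nat.one_le_iff_ne_zero.mpr ha) c, ih ha haS,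
      Nat.factorization_mul hp.ne_zero ha, hp.factorization]
    simp only [Finsupp.coe_add, Pi.add_apply, Nat.cast_add, add_zsmul, Finset.sum_add_distrib]
    rw [hsingle]

omit hR in
/-- From a positive rational to integer ends: `0 < a ∈ ℚ` is `A/D` with `A, D ≥ 1`. [folklore] -/
theorem exists_nat_mul_eq {a : ℚ} (ha : 0 < a) : ∃ A D : ℕ, 1 ≤ A ∧ 1 ≤ D ∧ (D : ℚ) * a = A := by
  obtain ⟨A, hA⟩ : ∃ A : ℕ, (A : ℤ) = a.num :=
    ⟨a.num.toNat, Int.toNat_of_nonneg (Rat.num_nonneg.mpr ha.le)⟩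
  have hnum : 0 < a.num := Rat.num_pos.mpr ha
  refine ⟨A, a.den, by omega, a.den_pos, ?_⟩
  rw [Rat.den_mul_eq_num, ← Int.cast_natCast, hA]

/-- **A dlog representation of unit length in normal form**: for `0 < a ∈ ℚ`,
`[(a, a+1), c/y] = Σ_{p ∈ S} Λ(p, C_p)` modulo relations, `S` a finite set of primes, `C_p ∈ ℚ`
vanishing off `S` — dilate by the denominator of `a`, split at the numerator, expand both
carriers over the primes, and merge. [cite: KontsevichZagier2001, §1.2 rules (1), (2)] -/
theorem dlog_unit_eq_sum {a : ℚ} (ha : 0 < a) (c : ℚ) :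
    ∃ (S : Finset ℕ) (C : ℕ → ℚ), (∀ p ∈ S, p.Prime) ∧ (∀ p, p ∉ S → C p = 0) ∧
      QuotientAddGroup.mk' relations (of (R a (a + 1) c)) =
        ∑ p ∈ S, QuotientAddGroup.mk' relations (of (R 1 p (C p))) := by
  obtain ⟨A, D, hA, hD, hDa⟩ := exists_nat_mul_eq ha
  have hA0 : (0:ℚ) < A := by exact_mod_cast hA
  have hD0 : (0:ℚ) < D := by exact_mod_cast hD
  have hAD0 : A + D ≠ 0 := by omega
  have hA0' : A ≠ 0 := by omega
  have hDa1 : (D : ℚ) * (a + 1) = ((A + D : ℕ) : ℚ) := by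
    push_cast
    linear_combination hDa
  -- dilate by `D`
  have h1 : of (R a (a + 1) c) - of (R A ((A + D : ℕ) : ℚ) c) ∈ relations := by
    refine dlog_scale_mem_relations (s := (D:ℚ)) (c := c) (R a (a + 1) c) (R A ((A + D : ℕ) : ℚ) c)
      (hR a (a + 1) c ha).1 ?_ ?_ ?_ ha hD0
    · rw [(hR A ((A + D : ℕ) : ℚ) c hA0).1, hDa, hDa1]
    · rw [(hR a (a + 1) c ha).2]
      exact fun _ _ => rfl
    · rw [(hR A ((A + D : ℕ) : ℚ) c hA0).2]
      exact fun _ _ => rfl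
  -- split `(1, A + D)` at `A`
  have h2 : of (R 1 ((A + D : ℕ) : ℚ) c) - of (R 1 A c) - of (R A ((A + D : ℕ) : ℚ) c) ∈
      relations := by
    refine split_mem_relations _ _ _ (hR 1 ((A + D : ℕ) : ℚ) c one_pos).1 (hR 1 A c one_pos).1
      (hR A ((A + D : ℕ) : ℚ) c hA0).1 ?_ ?_ ?_ ?_
    · exact_mod_cast hA
    · exact_mod_cast Nat.le_add_right A D
    · rw [(hR 1 A c one_pos).2, (hR 1 ((A + D : ℕ) : ℚ) c one_pos).2]
      exact fun _ _ => rfl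
    · rw [(hR A ((A + D : ℕ) : ℚ) c hA0).2, (hR 1 ((A + D : ℕ) : ℚ) c one_pos).2]
      exact fun _ _ => rfl
  have h3 : QuotientAddGroup.mk' relations (of (R A ((A + D : ℕ) : ℚ) c)) =
      QuotientAddGroup.mk' relations (of (R 1 ((A + D : ℕ) : ℚ) c)) -
        QuotientAddGroup.mk' relations (of (R 1 A c)) :=
    eq_sub_of_add_eq' (mk'_eq_add_of_sub_sub_mem h2).symm
  refine ⟨(A + D).primeFactors ∪ A.primeFactors,
    fun p => ((((A + D).factorization p : ℤ) - (A.factorization p : ℤ) : ℤ) : ℚ) * c, ?_, ?_, ?_⟩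
  · intro p hp
    rcases Finset.mem_union.mp hp with h | h <;> exact Nat.prime_of_mem_primeFactors h
  · intro p hp
    rw [Finset.mem_union, not_or] at hp
    have e1 : (A + D).factorization p = 0 :=
      Finsupp.notMem_support_iff.mp (by rw [Nat.support_factorization]; exact hp.1)
    have e2 : A.factorization p = 0 :=
      Finsupp.notMem_support_iff.mp (by rw [Nat.support_factorization]; exact hp.2)
    beta_reduce
    rw [e1, e2]
    simp
  · rw [mk'_eq_of_sub_mem h1, h3,
      carrier_eq_sum hR c ((A + D).primeFactors ∪ A.primeFactors) (A + D) hAD0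
        Finset.subset_union_left,
      carrier_eq_sum hR c ((A + D).primeFactors ∪ A.primeFactors) A hA0'
        Finset.subset_union_right,
      ← Finset.sum_sub_distrib]
    refine Finset.sum_congr rfl fun p _ => ?_
    rw [carrier_intCast_mul hR, sub_zsmul, sub_eq_add_neg]

end Carrier

/-! ## The simple rational pole -/

/-- **Normal form of a simple rational pole** (registered sub-goal `nf_pole_one` of crux
stmt-KontsevichZagierPeriods-3869, leaf `stub_boxRigidity`, split-denominator layer). For
`c, ρ ∈ ℚ` with `ρ ∉ [0,1]` and `T = [(0,1), c/(x − ρ)]`, there are `r ∈ ℚ`, a finite set of primes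
`S` and `C : S → ℚ` (extended by `0`) with
`[T] = [pt, r] + Σ_{p ∈ S} [(1,p), C_p/y]` in `FormalRep ⧸ relations`: one affine move
(`y = x − ρ` for `ρ < 0`, `y = ρ − x` for `ρ > 1`, rule 2) to a dlog representation
`[(a, a+1), ±c/y]`, `a > 0`, then `dlog_unit_eq_sum`; here `r = 0` (`[pt, 0]` is a relation).
[cite: KontsevichZagier2001, §1.1, §1.2 rules (1), (2)] -/
theorem nf_pole_one {R : ℚ → ℚ → ℚ → IntegralRep 1} {Z : ℚ → IntegralRep 0}
    (hR : ∀ a b c, 0 < a → (R a b c).domain = {x | x 0 ∈ Set.Ioo (a:ℝ) b} ∧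
      (R a b c).integrand = fun x => (c:ℝ) / x 0)
    (hZ : ∀ r, (Z r).domain = univ ∧ (Z r).integrand = fun _ => (r:ℝ)) {c ρ : ℚ}
    (hρ : (ρ:ℝ) ∉ Set.Icc (0:ℝ) 1) (T : IntegralRep 1)
    (hTd : T.domain = {x | x 0 ∈ Set.Ioo (0:ℝ) 1})
    (hTi : EqOn T.integrand (fun x => (c:ℝ) / (x 0 - ρ)) T.domain) :
    ∃ (r : ℚ) (S : Finset ℕ) (C : ℕ → ℚ), (∀ p ∈ S, p.Prime) ∧ (∀ p, p ∉ S → C p = 0) ∧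
      QuotientAddGroup.mk' relations (of T) = QuotientAddGroup.mk' relations (of (Z r)) +
        ∑ p ∈ S, QuotientAddGroup.mk' relations (of (R 1 p (C p))) := by
  -- Step 1: one affine move to a dlog representation on a positive rational slab of length one.
  obtain ⟨a, c', ha, hT⟩ : ∃ a c' : ℚ, 0 < a ∧ QuotientAddGroup.mk' relations (of T) =
      QuotientAddGroup.mk' relations (of (R a (a + 1) c')) := by
    rw [Set.mem_Icc, not_and_or, not_le, not_le] at hρ
    rcases hρ with hρ0 | hρ1
    · -- `ρ < 0`: the translation `y = x − ρ`
      have ha : 0 < -ρ := neg_pos.mpr (by exact_mod_cast hρ0)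
      refine ⟨-ρ, c, ha, PoleOneK11.mk'_eq_of_sub_mem ?_⟩
      refine affine_sub_mem_relations (s := 1) (t := -ρ) one_ne_zero T (R (-ρ) (-ρ + 1) c)
        (fun y => (c:ℝ) / y) ?_ ?_ ?_
      · have e1 : ((1:ℚ):ℝ) * 0 + ((-ρ:ℚ):ℝ) = ((-ρ:ℚ):ℝ) := by push_cast; ring
        have e2 : ((1:ℚ):ℝ) * 1 + ((-ρ:ℚ):ℝ) = ((-ρ + 1 : ℚ):ℝ) := by push_cast; ring
        rw [(hR (-ρ) (-ρ + 1) c ha).1, hTd, image_affine_slab_of_pos (by norm_num), e1, e2]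
      · rw [(hR (-ρ) (-ρ + 1) c ha).2]
        exact fun _ _ => rfl
      · intro x hx
        rw [hTi hx]
        show (c:ℝ) / (x 0 - ρ) = (c:ℝ) / (((1:ℚ):ℝ) * x 0 + ((-ρ:ℚ):ℝ)) * |((1:ℚ):ℝ)|
        rw [Rat.cast_one, Rat.cast_neg, abs_one, mul_one, one_mul, ← sub_eq_add_neg]
    · -- `1 < ρ`: the reflection `y = ρ − x`
      have ha : 0 < ρ - 1 := sub_pos.mpr (by exact_mod_cast hρ1)
      refine ⟨ρ - 1, -c, ha, PoleOneK11.mk'_eq_of_sub_mem ?_⟩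
      refine affine_sub_mem_relations (s := -1) (t := ρ) (by norm_num) T (R (ρ - 1) (ρ - 1 + 1) (-c))
        (fun y => ((-c : ℚ):ℝ) / y) ?_ ?_ ?_
      · have e1 : ((-1:ℚ):ℝ) * 1 + ((ρ:ℚ):ℝ) = ((ρ - 1 : ℚ):ℝ) := by push_cast; ring
        have e2 : ((-1:ℚ):ℝ) * 0 + ((ρ:ℚ):ℝ) = ((ρ - 1 + 1 : ℚ):ℝ) := by push_cast; ring
        rw [(hR (ρ - 1) (ρ - 1 + 1) (-c) ha).1, hTd, image_affine_slab_of_neg (by norm_num), e1, e2]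
      · rw [(hR (ρ - 1) (ρ - 1 + 1) (-c) ha).2]
        exact fun _ _ => rfl
      · intro x hx
        rw [hTi hx]
        show (c:ℝ) / (x 0 - ρ) = ((-c:ℚ):ℝ) / (((-1:ℚ):ℝ) * x 0 + ((ρ:ℚ):ℝ)) * |((-1:ℚ):ℝ)|
        have e1 : ((-1:ℚ):ℝ) * x 0 + ((ρ:ℚ):ℝ) = -(x 0 - ρ) := by push_cast; ring
        have e2 : |((-1:ℚ):ℝ)| = 1 := by norm_num
        rw [e1, e2, mul_one, Rat.cast_neg, neg_div_neg_eq]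
  -- Step 2: the dlog representation in normal form; the rational point is `[pt, 0]`, a relation.
  obtain ⟨S, C, hS, hC, hsum⟩ := PoleOneK11.dlog_unit_eq_sum hR ha c'
  refine ⟨0, S, C, hS, hC, ?_⟩
  have hZ0 : QuotientAddGroup.mk' relations (of (Z 0)) = 0 :=
    PoleOneK11.mk'_eq_zero_of_mem (pt_zero_mem_relations (Z 0) (by rw [(hZ 0).2]; simp))
  rw [hT, hsum, hZ0, zero_add]

end PoleOneK11

end Summit.KontsevichZagierPeriods.HurwitzMicroSectors.NormalFormPrinciple.PiBox.Dlog
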